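import Summits.CriticalPhenomena.CardyFormulaZ2.Theorems.CardySelfDualSegmentUniformMarginalityDefs
import Summits.CriticalPhenomena.CardyFormulaZ2.Theorems.CardySelfDualSegmentUniformMarginalityStubPextContinuous

/-!
# Negative lemmas for the crux `CardySelfDualSegment.UniformMarginality` (stmt-CriticalPhenomena-5472), I —
# mesh-uniformity is the whole content, and the modulus of continuity cannot be shape-uniform

Support file (refuter, cdisprove seat `refuter-cdisprove-stmt-CriticalPhenomena-5472-0`, cycle 1;
everything proved, no `sorry`, nothing defined (`combProb` is written out), no named fact) for the disproof programme of
the crux `UniformMarginality` ("UM": `∀ t₀ R ε, ∃ η, ∀ t, dist t t₀ < η → ∀ δ > 0,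
|P_t(R,δ) − P_{t₀}(R,δ)| < ε` for the crude crossing probabilities `P_t = cornerCrossingProb t` of the
corner family `M_t`; work file `Cruxes/UniformMarginality/Disproof.lean`).

* `integratedBound_of_uniformMarginality` — UM implies (hence, with the tree's
  `uniformMarginality_of_integratedBound`, IS) the line's `HeatFlow.IntegratedBound`.
* `cornerCrossingProb_continuous_in_parameter` — **positive control**: UM with `∃ η` and `∀ δ`
  exchanged (continuity in `t` at each FIXED mesh) holds, by the landed stub `stub_pextContinuous`.
  So the mesh-uniformity of `η` is the entire content of the crux (and only `δ → 0` matters: at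
  `δ ≥ δ₀` finitely many cylinder polynomials occur).
* `combProb_le`, `half_le_combProb_zero`, `comb_gap`, `comb_not_equicontinuous` — the
  COMB AMPLIFICATION inequality: `combProb N H t = 1 − (1 − ½(½ − t/4)^H)^N` (the crossing
  probability of `N` disjoint forced anti-diagonal zigzags with `H` north-east corners each — a corner
  vertex `v` with both `east(v)`, `north(v)` open has probability `½ − t/4`, the only `t`-dependent
  local statistic of `M_t`) satisfies `combProb(2^{H+1}, H, 0) ≥ ½` and
  `combProb(2^{H+1}, H, t) ≤ (1 − t/2)^H`, so the comb family is not equicontinuous at `t = 0`.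
* `not_shapeUniform_of_combDictionary` — hence, MODULO THE COMB DICTIONARY (for all `N, H` some
  conformal rectangle realises `combProb N H` as its crude `M_t`-crossing probability at some mesh —
  realised by the explicit slit rectangles `R_{X,R}` of the work file, checked there by exact
  computation but not formalised), the SHAPE-UNIFORM strengthening of UM (`∃ η` before `∀ R`) is
  false: the `η(t₀, R, ε)` of the crux, like the constant `C(R, t₀)` of the line's `RussoBound`, must
  depend on `R` through the lattice-scale geometry of `∂R`, not through its conformal modulus.
-/

noncomputable section

namespace Summit.CriticalPhenomena.CardyFormulaZ2.Theorems.UniformMarginality.Negative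

open MeasureTheory Literature.Probability.Percolation Literature.Probability.LatticeModels
  Literature.Probability.RandomPlanarGeometry
open Summit.CriticalPhenomena.CardyFormulaZ2.Cruxes.UniformMarginality.HeatFlow

/-! ### The crux and the line's integrated bound -/

/-- UM implies the line's `IntegratedBound` (converse of the tree's
`uniformMarginality_of_integratedBound`): `P t R δ = cornerCrossingProb t R δ = Pext R δ t` and
`dist t t₀ = |t − t₀|` on `unitInterval`. [folklore] -/
theorem integratedBound_of_uniformMarginality
    (h : Summit.CriticalPhenomena.CardyFormulaZ2.Theses.CardySelfDualSegment.UniformMarginality) :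
    IntegratedBound := by
  intro R t₀ ht₀ ε hε
  obtain ⟨η, hη, hmain⟩ := h ⟨t₀, ht₀⟩ R ε hε
  refine ⟨η, hη, fun δ hδ t ht htt₀ => ?_⟩
  have key := hmain ⟨t, ht⟩ (by rw [Subtype.dist_eq, Real.dist_eq]; exact htt₀) δ hδ
  have e1 : Pext R δ t = cornerCrossingProb ⟨t, ht⟩ R δ := Pext_coe R δ ⟨t, ht⟩
  have e2 : Pext R δ t₀ = cornerCrossingProb ⟨t₀, ht₀⟩ R δ := Pext_coe R δ ⟨t₀, ht₀⟩
  rw [e1, e2]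
  exact key

/-! ### Positive control: continuity in the parameter at every fixed mesh -/

/-- **UM without mesh-uniformity holds**: for every `t₀`, `R`, `ε > 0` and every FIXED mesh
`δ > 0` there is `η > 0` with `|P_t(R,δ) − P_{t₀}(R,δ)| < ε` whenever `dist t t₀ < η` — continuity of
the cylinder polynomial `Pext R δ` (`stub_pextContinuous`). The crux is this statement with `η`
uniform in `δ`. [folklore] -/
theorem cornerCrossingProb_continuous_in_parameter (t₀ : unitInterval) (R : ConformalRectangle)
    {ε : ℝ} (hε : 0 < ε) {δ : ℝ} (hδ : 0 < δ) :
    ∃ η > 0, ∀ t : unitInterval, dist t t₀ < η →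
      |cornerCrossingProb t R δ - cornerCrossingProb t₀ R δ| < ε := by
  have hc : Continuous (Pext R δ) := stub_pextContinuous R δ hδ
  obtain ⟨η, hη, h⟩ := Metric.continuous_iff.1 hc (t₀ : ℝ) ε hε
  refine ⟨η, hη, fun t ht => ?_⟩
  have hd : dist (t : ℝ) (t₀ : ℝ) < η := by rwa [← Subtype.dist_eq]
  have key := h (t : ℝ) hd
  rw [Real.dist_eq, Pext_coe, Pext_coe] at key
  exact key

/-! ### The comb amplification inequality -/

/-! Throughout, `combProb N H t := 1 − (1 − ½ (½ − t/4)^H)^N` (the crossing probability of `N`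
disjoint forced zigzags with `H` corners each) is written out explicitly — nothing is defined. -/

/-- Union (Bernoulli) bound: `combProb N H t ≤ N · ½ (½ − t/4)^H` for `t ∈ [0, 1]`. [folklore] -/
theorem combProb_le (N H : ℕ) {t : ℝ} (ht0 : 0 ≤ t) (ht1 : t ≤ 1) :
    (1 - (1 - (1 / 2 : ℝ) * (1 / 2 - t / 4) ^ H) ^ N) ≤ N * ((1 / 2 : ℝ) * (1 / 2 - t / 4) ^ H) := by
  set x : ℝ := (1 / 2 : ℝ) * (1 / 2 - t / 4) ^ H with hx
  have hb : (0 : ℝ) ≤ 1 / 2 - t / 4 := by linarith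
  have hx0 : 0 ≤ x := mul_nonneg (by norm_num) (pow_nonneg hb H)
  have hb1 : (1 / 2 - t / 4 : ℝ) ≤ 1 := by linarith
  have hpow : (1 / 2 - t / 4 : ℝ) ^ H ≤ 1 := pow_le_one₀ hb hb1
  have hx2 : x ≤ 1 / 2 := by rw [hx]; linarith
  have hB := one_add_mul_le_pow (show (-2 : ℝ) ≤ -x by linarith) N
  have h1 : (1 : ℝ) + -x = 1 - x := by ring
  have h2 : (N : ℝ) * -x = -((N : ℝ) * x) := by ring
  rw [h1, h2] at hB
  linarith

/-- At `t = 0` with `N = 2^{H+1}` zigzags the comb is crossed with probability at least `½`, for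
EVERY `H`: `(1 − 2^{−(H+1)})^{2^{H+1}} ≤ e^{−1} < ½`. [folklore] -/
theorem half_le_combProb_zero (H : ℕ) :
    (1 / 2 : ℝ) ≤ (1 - (1 - (1 / 2 : ℝ) * (1 / 2 - 0 / 4) ^ H) ^ (2 ^ (H + 1))) := by
  have hx : (1 / 2 : ℝ) * (1 / 2 - 0 / 4) ^ H = (1 / 2) ^ (H + 1) := by
    rw [zero_div, sub_zero, pow_succ']
  rw [hx]
  set x : ℝ := (1 / 2 : ℝ) ^ (H + 1) with hxdef
  have hx0 : 0 < x := by positivity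
  have hx1 : x ≤ 1 / 2 := by
    have : ((1 : ℝ) / 2) ^ H ≤ 1 := pow_le_one₀ (by norm_num) (by norm_num)
    rw [hxdef, pow_succ']
    linarith
  have hNx : (2 : ℝ) ^ (H + 1) * x = 1 := by rw [hxdef, ← mul_pow]; norm_num
  have h1 : (1 - x) ^ (2 ^ (H + 1)) ≤ Real.exp (-x) ^ (2 ^ (H + 1)) :=
    pow_le_pow_left₀ (by linarith) (Real.one_sub_le_exp_neg x) _
  have h2 : Real.exp (-x) ^ (2 ^ (H + 1)) = Real.exp (-1) := by
    rw [← Real.exp_nat_mul]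
    congr 1
    push_cast
    rw [mul_neg, hNx]
  have h3 : Real.exp (-1) ≤ 1 / 2 := by
    have he : (2 : ℝ) < Real.exp 1 := lt_trans (by norm_num) Real.exp_one_gt_d9
    have hpos : 0 < Real.exp (-1) := Real.exp_pos _
    have hmul : Real.exp (-1) * Real.exp 1 = 1 := by rw [← Real.exp_add]; norm_num
    nlinarith
  rw [h2] at h1
  linarith

/-- **Amplification gap**: for `t ∈ [0,1]` with `(1 − t/2)^H ≤ ¼`,
`combProb(2^{H+1}, H, 0) − combProb(2^{H+1}, H, t) ≥ ¼` (indeed `combProb(2^{H+1}, H, t) ≤ (1 − t/2)^H`).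
[folklore] -/
theorem comb_gap (H : ℕ) {t : ℝ} (ht0 : 0 ≤ t) (ht1 : t ≤ 1) (hH : (1 - t / 2) ^ H ≤ 1 / 4) :
    1 / 4 ≤ (1 - (1 - (1 / 2 : ℝ) * (1 / 2 - 0 / 4) ^ H) ^ (2 ^ (H + 1)))
      - (1 - (1 - (1 / 2 : ℝ) * (1 / 2 - t / 4) ^ H) ^ (2 ^ (H + 1))) := by
  have hup := combProb_le (2 ^ (H + 1)) H ht0 ht1
  have hid : ((2 ^ (H + 1) : ℕ) : ℝ) * ((1 / 2 : ℝ) * (1 / 2 - t / 4) ^ H) = (1 - t / 2) ^ H := by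
    push_cast
    have hq : (1 / 2 - t / 4 : ℝ) = 1 / 2 * (1 - t / 2) := by ring
    rw [hq, mul_pow]
    have h2 : (2 : ℝ) ^ (H + 1) * ((1 / 2) * (1 / 2) ^ H) = 1 := by
      rw [← pow_succ', ← mul_pow]; norm_num
    calc (2 : ℝ) ^ (H + 1) * (1 / 2 * ((1 / 2) ^ H * (1 - t / 2) ^ H))
        = ((2 : ℝ) ^ (H + 1) * ((1 / 2) * (1 / 2) ^ H)) * (1 - t / 2) ^ H := by ring
      _ = (1 - t / 2) ^ H := by rw [h2, one_mul]
  have hlow := half_le_combProb_zero H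
  rw [hid] at hup
  linarith

/-- **The comb family is not equicontinuous at `t = 0`**: no single `η` serves all combs.
[folklore] -/
theorem comb_not_equicontinuous :
    ¬ ∀ ε > (0 : ℝ), ∃ η > (0 : ℝ), ∀ (N H : ℕ) (t : ℝ), 0 ≤ t → t ≤ 1 → t < η →
        |(1 - (1 - (1 / 2 : ℝ) * (1 / 2 - t / 4) ^ H) ^ N)
          - (1 - (1 - (1 / 2 : ℝ) * (1 / 2 - 0 / 4) ^ H) ^ N)| < ε := by
  intro h
  obtain ⟨η, hη, hmain⟩ := h (1 / 4) (by norm_num)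
  set t : ℝ := min (η / 2) 1 with ht
  have ht0 : 0 < t := lt_min (by linarith) one_pos
  have ht1 : t ≤ 1 := min_le_right _ _
  have htη : t < η := lt_of_le_of_lt (min_le_left _ _) (by linarith)
  obtain ⟨H, hH⟩ := exists_pow_lt_of_lt_one (show (0 : ℝ) < 1 / 4 by norm_num)
    (show (1 - t / 2 : ℝ) < 1 by linarith)
  have hgap := comb_gap H ht0.le ht1 hH.le
  have habs := hmain (2 ^ (H + 1)) H t ht0.le ht1 htη
  rw [abs_lt] at habs
  linarith [habs.1, habs.2]

/-! ### No shape-uniform modulus of continuity, modulo the comb dictionary -/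

/-- **¬(shape-uniform marginality), modulo the comb dictionary.** If every abstract comb is realised
— for all `N, H` some conformal rectangle `R` and mesh `δ > 0` have
`cornerCrossingProb t R δ = combProb N H t` for all `t` (the explicit slit rectangles `R_{X,R}` of
`Cruxes/UniformMarginality/Disproof.lean` do this at `δ = 1/√2`; checked there by exact computation)
— then the strengthening of the crux with `∃ η` in front of `∀ R` is false. [folklore] -/
theorem not_shapeUniform_of_combDictionary
    (hD : ∀ N H : ℕ, ∃ (R : ConformalRectangle) (δ : ℝ), 0 < δ ∧
      ∀ t : unitInterval, cornerCrossingProb t R δ = (1 - (1 - (1 / 2 : ℝ) * (1 / 2 - (t : ℝ) / 4) ^ H) ^ N)) :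
    ¬ ∀ (t₀ : unitInterval) (ε : ℝ), 0 < ε → ∃ η > 0, ∀ (R : ConformalRectangle) (t : unitInterval),
        dist t t₀ < η → ∀ δ : ℝ, 0 < δ →
          |cornerCrossingProb t R δ - cornerCrossingProb t₀ R δ| < ε := by
  intro h
  apply comb_not_equicontinuous
  intro ε hε
  obtain ⟨η, hη, hmain⟩ := h 0 ε hε
  refine ⟨η, hη, fun N H t ht0 ht1 htη => ?_⟩
  obtain ⟨R, δ, hδ, hR⟩ := hD N H
  have hdist : dist (⟨t, ⟨ht0, ht1⟩⟩ : unitInterval) 0 < η := by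
    rw [Subtype.dist_eq, Real.dist_eq]
    simpa [abs_of_nonneg ht0] using htη
  have key := hmain R ⟨t, ⟨ht0, ht1⟩⟩ hdist δ hδ
  rw [hR, hR] at key
  simpa using key

end Summit.CriticalPhenomena.CardyFormulaZ2.Theorems.UniformMarginality.Negative

end
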